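import Literature.NumberTheory.EllipticCurves.ZpExtensionEisensteinTwistResidualTorsionProofs
import HarnessLib

/-!
# `𝓛_s(T_𝔮) ⊆ 𝓛_1(T_pE)`, Frobenius part: an element acting trivially on `E[p^k] ⊗ A_{m,k}(ψ)` modulo `p^s`
# (`s ≥ 1`) acts trivially on `E[p]`, i.e. modulo `p` on `E[p^k]` (proofs file)

Topic `NumberTheory/EllipticCurves`. THEOREMS ONLY; no definition, no named fact, no instance, no `sorry`.

Howard, Compositio 140 (2004), Def. 1.2.1: `I_ℓ` = the smallest ideal containing `ℓ + 1` modulo which `Frob_λ` acts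
trivially, `𝓛_k(T) = {ℓ : I_ℓ ⊆ p^k}`; Thm. 1.6.1 asks `𝓛_s(T) ⊆ 𝓛` for `s ≫ 0` (tree: `Howard2004.kolyvaginPrimes`,
`AdicTower.kolyvaginPrimes`, `DVRSetting.LargePrimes`). For the specialised triple at the Eisenstein prime the prime set
is `𝓛 = 𝓛_E = 𝓛_1(T_pE)` (x9-p1 LEAD g3, SKELETON-v9-PLAN STUB 1d; x10b-p2 LEAD g5, 2026-08-28: «writing
`Frob_λ = F ⊗ u` … `c ≡ 1 (mod p)`, so `Frob_λ ≡ 1` on `E[p]` and `p ∣ ℓ+1` — no class field theory»). This file is the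
`T_𝔮`-specific half of that inclusion, on the landed carrier (`ZpExtension.eisensteinTwist`), for EVERY `κ`, `m, k ≥ 1`:

* `EisensteinCoeff.span_natCast_pow_le_span_mk_X` — `(p^s) ⊆ ([T]) = 𝔪` for `s ≥ 1`;
* `EisensteinCoeff.dvd_of_natCast_mem_span_pow` — `(n : A_{m,k}) ∈ (p^s)`, `s ≥ 1` ⇒ `p ∣ n` (the `ℓ + 1` clause);
* **`WeierstrassCurve.smul_eq_self_geomTorsion_prime_of_eisensteinTwist_sub_mem`** — if
  `σ · x − x ∈ (p^s) • (E[p^k] ⊗ A_{m,k})` for all `x` (`s ≥ 1`), then `σ • Q = Q` for every `Q ∈ E[p]`;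
* **`WeierstrassCurve.exists_smul_sub_eq_prime_nsmul_of_eisensteinTwist_sub_mem`** — … and `σ • P − P ∈ p·E[p^k]` for every
  `P ∈ E[p^k]` (the level-`k` form of «`Frob_λ ≡ 1` on `T_pE/p`», membership in `𝓛_1(T_pE)`).
The degree-two / unramified clauses of `𝓛₀` and the packaging into `AdicTower.kolyvaginPrimes` belong to the tower's
owner (D1 `specSetting`).

Cell `pub/bsd-print-x9`, seat `bsd-line-x9-p1-w2` (g5), v9-plan STUB 1 (`LargePrimes`) of the shared μ-item on crux
stmt-BirchSwinnertonDyer-27077.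

References: [Howard2004HeegnerKolyvagin] Def. 1.2.1 (arXiv Def. 2.2.1), Thm. 1.6.1 («𝓛_s(T) ⊂ 𝓛»), proof of Prop. 2.1.3.
-/

noncomputable section

open scoped TensorProduct

namespace Literature.NumberTheory.EllipticCurves.IwasawaAlgebra.EisensteinCoeff

variable (p : ℕ) [hp : Fact p.Prime]

/-- `(p^s) ⊆ ([T])` in `A_{m,k}` for `s ≥ 1` (`[p] = −[T]^m`). [cite: Howard2004HeegnerKolyvagin, Def. 1.2.1 and proof of Prop. 2.1.3] -/
theorem span_natCast_pow_le_span_mk_X {m : ℕ} (hm : 1 ≤ m) (k : ℕ) {s : ℕ} (hs : 1 ≤ s) :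
    Ideal.span {((p : ℕ) : EisensteinCoeff p m k) ^ s} ≤
      Ideal.span {(Ideal.Quotient.mk _ PowerSeries.X : EisensteinCoeff p m k)} := by
  rw [Ideal.span_le, Set.singleton_subset_iff, SetLike.mem_coe]
  exact Ideal.pow_mem_of_mem _ (natCast_mem_span_mk_X p hm k) s hs

/-- **The `ℓ + 1` clause**: `(n : A_{m,k}) ∈ (p^s)` with `s ≥ 1` (`m, k ≥ 1`) forces `p ∣ n` (reduce with the residue
character `A_{m,k} → 𝔽_p`). [cite: Howard2004HeegnerKolyvagin, Def. 1.2.1 (ℓ + 1 ∈ I_ℓ ⊆ p^k)] -/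
theorem dvd_of_natCast_mem_span_pow {m k : ℕ} (hm : 1 ≤ m) (hk : 1 ≤ k) {s : ℕ} (hs : 1 ≤ s) {n : ℕ}
    (hn : (n : EisensteinCoeff p m k) ∈ Ideal.span {((p : ℕ) : EisensteinCoeff p m k) ^ s}) : p ∣ n := by
  have hker : (n : EisensteinCoeff p m k) ∈ RingHom.ker (residueChar p hm hk) := by
    rw [ker_residueChar]
    exact span_natCast_pow_le_span_mk_X p hm k hs hn
  rw [RingHom.mem_ker, residueChar_natCast, ZMod.natCast_eq_zero_iff] at hker
  exact hker

end Literature.NumberTheory.EllipticCurves.IwasawaAlgebra.EisensteinCoeff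

namespace WeierstrassCurve

open Literature.NumberTheory.EllipticCurves Literature.NumberTheory.GaloisRepresentations Field
open Literature.NumberTheory.EllipticCurves.IwasawaAlgebra

variable {K : Type} [Field K] (W : WeierstrassCurve K) [W.IsElliptic] {p : ℕ} [hp : Fact p.Prime]
  (κ : ZpExtension K p) {m : ℕ} (hm : 1 ≤ m) {k : ℕ}

/-- **`Frob ≡ 1 (mod p^s)` on `T_𝔮/p^k` ⇒ `Frob = 1` on `E[p]`.** If `σ ∈ Γ_K` satisfies `σ · x − x ∈ (p^s) • (E[p^k] ⊗ A_{m,k})`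
for every `x` (the ψ-twisted action, `s ≥ 1`), then `σ` fixes `E[p]` pointwise: `(p^s) ⊆ 𝔪` and the residual presentation
`E[p^k] ⊗ A_{m,k} ↠ E[p]` is equivariant towards the UNTWISTED `E[p]` (`apply_residual_eq_self_of_forall_sub_mem`).
[cite: Howard2004HeegnerKolyvagin, Def. 1.2.1 and Thm. 1.6.1 («𝓛_s(T) ⊂ 𝓛»), proof of Prop. 2.1.3] -/
theorem smul_eq_self_geomTorsion_prime_of_eisensteinTwist_sub_mem (hk : 1 ≤ k) {s : ℕ} (hs : 1 ≤ s)
    {σ : absoluteGaloisGroup K}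
    (hσ : ∀ x : EisensteinCoeff.Twisted p m k (geomTorsion W ((p : ℤ) ^ k)),
      κ.eisensteinTwist (W.torsionGaloisModule ((p : ℤ) ^ k)) hm k σ x - x ∈
        (Ideal.span {((p : ℕ) : EisensteinCoeff p m k) ^ s} •
          (⊤ : Submodule (EisensteinCoeff p m k) (EisensteinCoeff.Twisted p m k (geomTorsion W ((p : ℤ) ^ k))))))
    (Q : geomTorsion W (p : ℤ)) : σ • Q = Q := by
  obtain ⟨r, -, hrsurj, hrker, hrρ⟩ := W.exists_geomTorsion_primePow_reduction (p := p) hk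
  have h := κ.apply_residual_eq_self_of_forall_sub_mem (W.torsionGaloisModule ((p : ℤ) ^ k)) hm k hk
    (W.torsionGaloisModule (p : ℤ)) r hrsurj hrker hrρ (W.prime_nsmul_geomTorsion_eq_zero (p := p))
    (EisensteinCoeff.span_natCast_pow_le_span_mk_X p hm k hs) hσ Q
  rwa [torsionGaloisModule_apply_apply] at h

/-- **… hence `σ • P − P ∈ p·E[p^k]` for every `P ∈ E[p^k]`** (the level-`k` reading of «`Frob_λ ≡ 1` modulo `p` on
`T_pE`», i.e. of `λ ∈ 𝓛_1(T_pE)`): `p^{k−1}(σP − P) = σ(p^{k−1}P) − p^{k−1}P = 0` by the previous theorem, and the kernel of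
`p^{k−1}· : E[p^k] → E[p]` is `p·E[p^k]`. [cite: Howard2004HeegnerKolyvagin, Def. 1.2.1 and Thm. 1.6.1 («𝓛_s(T) ⊂ 𝓛»)] -/
theorem exists_smul_sub_eq_prime_nsmul_of_eisensteinTwist_sub_mem (hk : 1 ≤ k) {s : ℕ} (hs : 1 ≤ s)
    {σ : absoluteGaloisGroup K}
    (hσ : ∀ x : EisensteinCoeff.Twisted p m k (geomTorsion W ((p : ℤ) ^ k)),
      κ.eisensteinTwist (W.torsionGaloisModule ((p : ℤ) ^ k)) hm k σ x - x ∈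
        (Ideal.span {((p : ℕ) : EisensteinCoeff p m k) ^ s} •
          (⊤ : Submodule (EisensteinCoeff p m k) (EisensteinCoeff.Twisted p m k (geomTorsion W ((p : ℤ) ^ k))))))
    (P : geomTorsion W ((p : ℤ) ^ k)) : ∃ Q : geomTorsion W ((p : ℤ) ^ k), σ • P - P = p • Q := by
  obtain ⟨r, -, hrsurj, hrker, hrρ⟩ := W.exists_geomTorsion_primePow_reduction (p := p) hk
  have hfix : ∀ Q : geomTorsion W (p : ℤ), σ • Q = Q :=
    W.smul_eq_self_geomTorsion_prime_of_eisensteinTwist_sub_mem κ hm hk hs hσ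
  have h0 : r (σ • P - P) = 0 := by
    rw [map_sub, sub_eq_zero]
    have h1 := hrρ σ P
    rw [torsionGaloisModule_apply_apply, torsionGaloisModule_apply_apply, hfix] at h1
    exact h1
  exact (hrker _).mp h0

end WeierstrassCurve

end
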